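import Summits.KontsevichZagierPeriods.KontsevichZagierPeriods.Theorems.SoloInformedGlobalStep
import Summits.KontsevichZagierPeriods.KontsevichZagierPeriods.Theorems.SoloInformedPresRat
import Summits.KontsevichZagierPeriods.KontsevichZagierPeriods.Theorems.SoloInformedAlgTheorem2D
import Summits.KontsevichZagierPeriods.KontsevichZagierPeriods.Theorems.SoloInformedAnFibre
import HarnessLib

/-!
# PRES-RAT(2): presentability of rational integrands on semialgebraic plane domains

Solo programme `solo-KontsevichZagierPeriods-informed`, session s111, kernel project PRES-RAT(2),
final step (δ-4).  **THEOREM PRES-RAT(2)** (`soloInformed_presRat_two`): every absolutely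
convergent integral `∫_σ P/Q dx dy` with `σ ⊆ ℝ²` `ℚ`-semialgebraic and `P, Q ∈ ℚ[x, y]`,
`Q ≠ 0` on `σ`, is *presentable*: a nonzero integer multiple of it is equivalent, under the
three Kontsevich–Zagier rules (additivity, algebraic change of variables, Newton–Leibniz), to
an integer combination of volumes of compact `ℚ`-semialgebraic sets presented on cubes.
Consequently (`soloInformed_kzpUpTo_two_of_ayoubKZeffQ`) the Kontsevich–Zagier period
conjecture for periods given by rational integrands in dimension `≤ 2` follows from Ayoub's
effective relative period conjecture.

Assembly: semi-canonical reduction to bounded rational pieces (Literature); an affine chart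
onto the open unit square; null removal of `σ ∖ interior σ`; the boundary hypersurface
(FRONTIER-SIGN); reduction to lowest terms; the squarefree hull `F = rad(G · Q₁)`; the polar
set on the closure is finite (NONINT, using absolute convergence) and `Sing F` is finite
(SING-FINITE); the GLOBAL THEOREM.

References: Kontsevich–Zagier, *Periods* (2001), §1.2, §4.1; Ayoub, *Une version relative de la
conjecture des périodes de Kontsevich–Zagier* (2015); Viu-Sos, arXiv:1509.01097.
-/

noncomputable section

open scoped BigOperators Topology
open MeasureTheory Set Filter Metric
open Literature.NumberTheory.Transcendental Literature.NumberTheory.Transcendental.KZ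
open Literature.ModelTheory.ExponentialFields (IsSemialgebraic)

namespace Summit.KontsevichZagierPeriods.KontsevichZagierPeriods.Theorems

variable {K : Type*} [Field K] [Algebra K ℝ]

/-! ### The squarefree hull -/

/-- A polynomial vanishes wherever a polynomial dividing one of its powers... concretely: if
`a ∣ F ^ n` then `Z(a) ⊆ Z(F)`. -/
theorem soloInformed_aeval_eq_zero_of_dvd_pow {a F : MvPolynomial (Fin 2) K} {n : ℕ}
    (h : a ∣ F ^ n) {z : Fin 2 → ℝ} (hz : (MvPolynomial.aeval z a : ℝ) = 0) :
    (MvPolynomial.aeval z F : ℝ) = 0 := by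
  obtain ⟨t, ht⟩ := h
  have h' := congrArg (fun P => (MvPolynomial.aeval z P : ℝ)) ht
  simp only [map_pow, map_mul, hz, zero_mul] at h'
  exact (pow_eq_zero_iff'.1 h').1

section Coprime

variable [CharZero K]

/-- **Presentability in lowest terms.**  Let `Ω ⊆ [0,1]²` be open and `ℚ`-semialgebraic with
`frontier Ω ⊆ Z(G)` (`G ≠ 0`), and `P₁/Q₁` a fraction in lowest terms over `K` with `Q₁ ≠ 0`
on `Ω`.  Then `P₁/Q₁` is presentable on `Ω`.  With `F = rad(G Q₁)` (squarefree, finitely many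
singular points), every representation `(Ω, ρ)` of `P₁/Q₁` is absolutely convergent, so the
polar set `Z(Q₁) ∩ closure Ω` is finite (NONINT) and the GLOBAL THEOREM applies.
[this work] -/
theorem soloInformed_presOn_of_coprime
    (hK : ∀ c : K, IsAlgebraic ℚ (algebraMap K ℝ c)) (hKrc : SoloInformedRealRootClosed K)
    {Ω : Set (Fin 2 → ℝ)} (hΩo : IsOpen Ω) (hΩ : IsSemialgebraic ℚ Ω)
    (hΩc : Ω ⊆ soloInformedCube 2) {G P₁ Q₁ : MvPolynomial (Fin 2) K} (hG : G ≠ 0)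
    (hfr : ∀ z ∈ frontier Ω, (MvPolynomial.aeval z G : ℝ) = 0) (hQ₁ : Q₁ ≠ 0)
    (hcop : ∀ d, d ∣ P₁ → d ∣ Q₁ → IsUnit d)
    (hQ : ∀ z ∈ Ω, (MvPolynomial.aeval z Q₁ : ℝ) ≠ 0) :
    SoloInformedPresOn Ω (fun z => (MvPolynomial.aeval z P₁ : ℝ) / MvPolynomial.aeval z Q₁) := by
  classical
  letI := (UniqueFactorizationMonoid.strongNormalizationMonoid
    (α := MvPolynomial (Fin 2) K)).toNormalizationMonoid
  have hGQ : G * Q₁ ≠ 0 := mul_ne_zero hG hQ₁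
  set F := UniqueFactorizationMonoid.radical (G * Q₁) with hF
  have hFsq : Squarefree F := UniqueFactorizationMonoid.squarefree_radical
  obtain ⟨n, hn⟩ := UniqueFactorizationMonoid.exists_dvd_radical_self_pow hGQ
  have hfrF : ∀ z ∈ frontier Ω, (MvPolynomial.aeval z F : ℝ) = 0 := fun z hz =>
    soloInformed_aeval_eq_zero_of_dvd_pow hn (by rw [map_mul, hfr z hz, zero_mul])
  have hsing : (soloInformedSingSet F).Finite := soloInformed_singSet_finite_of_squarefree hFsq
  intro ρ hdom hρ
  have hint : IntegrableOn ρ.integrand Ω := hdom ▸ ρ.integrableOn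
  have hpol : ({z : Fin 2 → ℝ | (MvPolynomial.aeval z Q₁ : ℝ) = 0} ∩ closure Ω).Finite :=
    soloInformed_finite_polarSet_closure (N := P₁) hΩo (fun z hz => hfrF z hz) hFsq hQ₁
      (fun r hr hrq => (UniqueFactorizationMonoid.dvd_radical_iff_of_irreducible hr hGQ).2
        (dvd_mul_of_dvd_right hrq G))
      (fun r hr hrq hrp => hr.not_isUnit (hcop r hrp hrq)) hQ hρ hint
  exact soloInformed_presOn_global hK hKrc hΩo hΩ hΩc hfrF hsing
    (soloInformed_specialSet_finite hsing hpol) P₁ ρ hdom hρ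

/-- **Presentability of rational integrands in the open square.**  For `S ⊆ (0,1)²`
`ℚ`-semialgebraic and `P/Q` with `P, Q ∈ K[x, y]`, `Q ≠ 0` on `S`, the function `P/Q` is
presentable on `S`: pass to `interior S` (null difference), take the boundary polynomial of
FRONTIER-SIGN, reduce to lowest terms and apply the previous theorem. [this work] -/
theorem soloInformed_presOn_rational_openCube
    (hK : ∀ c : K, IsAlgebraic ℚ (algebraMap K ℝ c)) (hKrc : SoloInformedRealRootClosed K)
    {S : Set (Fin 2 → ℝ)} (hS : IsSemialgebraic ℚ S) (hSc : S ⊆ soloInformedOpenCube 2)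
    (P Q : MvPolynomial (Fin 2) K) (hQ : ∀ z ∈ S, (MvPolynomial.aeval z Q : ℝ) ≠ 0) :
    SoloInformedPresOn S (fun z => (MvPolynomial.aeval z P : ℝ) / MvPolynomial.aeval z Q) := by
  classical
  set Ω := interior S with hΩ_def
  have hΩo : IsOpen Ω := isOpen_interior
  have hΩsa : IsSemialgebraic ℚ Ω :=
    Literature.ModelTheory.ExponentialFields.isSemialgebraic_interior hS
  have hΩS : Ω ⊆ S := interior_subset
  have hΩc : Ω ⊆ soloInformedCube 2 := fun z hz i =>
    ⟨(hSc (hΩS hz) i).1.le, (hSc (hΩS hz) i).2.le⟩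
  -- `S ∖ interior S` is null
  obtain ⟨Q₀, hQ₀, hsub⟩ := hS.subset_interior_union
  have hnull : volume (S \ Ω) = 0 := by
    have hsub' : S \ Ω ⊆ ⋃ q ∈ Q₀, {x | x ∈ soloInformedOpenCube 2 ∧
        (MvPolynomial.aeval x q : ℝ) = 0} := by
      rintro x ⟨hxS, hxΩ⟩
      rcases hsub hxS with h | h
      · exact (hxΩ h).elim
      · simp only [mem_iUnion, mem_setOf_eq, exists_prop] at h ⊢
        obtain ⟨q, hq, hxq⟩ := h
        exact ⟨q, hq, hSc hxS, hxq⟩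
    refine measure_mono_null hsub' ((measure_biUnion_null_iff Q₀.countable_toSet).2
      fun q hq => soloInformed_volume_zeroSet_openCube fun h => ?_)
    obtain ⟨x, hx⟩ := hQ₀ q hq
    exact hx (by rw [h, map_zero])
  refine soloInformed_presOn_of_subset_null hΩsa hΩS hnull ?_
  by_cases hne : Ω = ∅
  · rw [hne]; exact soloInformed_presOn_empty _
  obtain ⟨z₀, hz₀⟩ := Set.nonempty_iff_ne_empty.2 hne
  -- the boundary polynomial
  obtain ⟨G, hG0, -, hGfr⟩ := soloInformed_exists_frontier_interior_subset_zeroSet hS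
  set GK : MvPolynomial (Fin 2) K := MvPolynomial.map (algebraMap ℚ K) G with hGK
  have hGK0 : GK ≠ 0 := fun h =>
    hG0 (MvPolynomial.map_injective _ (algebraMap ℚ K).injective (h.trans (map_zero _).symm))
  have hGKfr : ∀ z ∈ frontier Ω, (MvPolynomial.aeval z GK : ℝ) = 0 := fun z hz => by
    rw [hGK, MvPolynomial.aeval_map_algebraMap]; exact hGfr hz
  -- lowest terms
  letI := UniqueFactorizationMonoid.toGCDMonoid (MvPolynomial (Fin 2) K)
  obtain ⟨P₁, Q₁, hP, hQ', hu⟩ := extract_gcd P Q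
  set g := gcd P Q with hg_def
  have hQΩ : ∀ z ∈ Ω, (MvPolynomial.aeval z Q : ℝ) ≠ 0 := fun z hz => hQ z (hΩS hz)
  have hQ₁Ω : ∀ z ∈ Ω, (MvPolynomial.aeval z Q₁ : ℝ) ≠ 0 := fun z hz h =>
    hQΩ z hz (by rw [hQ', map_mul, h, mul_zero])
  have hQ₁ : Q₁ ≠ 0 := fun h => hQ₁Ω z₀ hz₀ (by rw [h, map_zero])
  have hcop : ∀ d, d ∣ P₁ → d ∣ Q₁ → IsUnit d := fun d hdp hdq =>
    isUnit_of_dvd_unit (dvd_gcd hdp hdq) hu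
  have hfun : EqOn (fun z => (MvPolynomial.aeval z P₁ : ℝ) / MvPolynomial.aeval z Q₁)
      (fun z => (MvPolynomial.aeval z P : ℝ) / MvPolynomial.aeval z Q) Ω := by
    intro z hz
    have hg : (MvPolynomial.aeval z g : ℝ) ≠ 0 := fun h =>
      hQΩ z hz (by rw [hQ', map_mul, h, zero_mul])
    simp only
    rw [hP, hQ', map_mul, map_mul, mul_div_mul_left _ _ hg]
  exact (soloInformed_presOn_congr hfun).1
    (soloInformed_presOn_of_coprime hK hKrc hΩo hΩsa hΩc hGK0 hGKfr hQ₁ hcop hQ₁Ω)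

end Coprime

/-! ### Affine charts with vertex data in `K` (KZ rule (2)) -/

/-- **Transport along a diagonal affine chart.**  For `Φ(z) = a + diag(b) z` with
`a, b ∈ K²`, `b₀ b₁ ≠ 0`: presentability of `|b₀ b₁| · (P ∘ Φ)/(D ∘ Φ)` on
`{z ∈ (0,1)² | Φ z ∈ Ω}` gives presentability of `P/D` on `Ω ∩ Φ((0,1)²)`. [this work] -/
theorem soloInformed_presOn_inter_diagImage (hK : ∀ c : K, IsAlgebraic ℚ (algebraMap K ℝ c))
    {Ω : Set (Fin 2 → ℝ)} (hΩ : IsSemialgebraic ℚ Ω) (a b : Fin 2 → K)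
    (hb : ∀ i, algebraMap K ℝ (b i) ≠ 0) (P D : MvPolynomial (Fin 2) K)
    (h : SoloInformedPresOn {z | z ∈ soloInformedOpenCube 2 ∧
        soloInformedDiagMoveR (fun i => algebraMap K ℝ (a i)) (fun i => algebraMap K ℝ (b i)) z
          ∈ Ω}
      (fun z => (MvPolynomial.aeval z (MvPolynomial.C (soloInformedAbsK (b 0 * b 1)) *
          soloInformedDiagSubstK a b P) : ℝ) /
        MvPolynomial.aeval z (soloInformedDiagSubstK a b D))) :
    SoloInformedPresOn (Ω ∩ soloInformedDiagMoveR (fun i => algebraMap K ℝ (a i))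
        (fun i => algebraMap K ℝ (b i)) '' soloInformedOpenCube 2)
      (fun z => (MvPolynomial.aeval z P : ℝ) / MvPolynomial.aeval z D) := by
  set α : Fin 2 → ℝ := fun i => algebraMap K ℝ (a i) with hα
  set β : Fin 2 → ℝ := fun i => algebraMap K ℝ (b i) with hβ
  set Φ := soloInformedDiagMoveR α β with hΦ
  set S : Set (Fin 2 → ℝ) := {z | z ∈ soloInformedOpenCube 2 ∧ Φ z ∈ Ω} with hS_def
  have hS : IsSemialgebraic ℚ S := by
    convert soloInformed_isSemialgebraic_sep_preimage hK (isSemialgebraic_soloInformedOpenCube 2)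
      (soloInformedDiagPolyK a b) hΩ using 1
    ext z
    rw [mem_setOf_eq, mem_setOf_eq, hΦ, soloInformed_diagMoveR_eq_aeval]
  have himg : Ω ∩ Φ '' soloInformedOpenCube 2 = Φ '' S := by
    ext w
    constructor
    · rintro ⟨hw, z, hz, rfl⟩
      exact ⟨z, ⟨hz, hw⟩, rfl⟩
    · rintro ⟨z, ⟨hz, hw⟩, rfl⟩
      exact ⟨hw, z, hz, rfl⟩
  rw [himg]
  have hJ : IsSemialgebraicFunOn ℚ S fun _ : Fin 2 → ℝ => |(soloInformedDiagDerivR β).det| := by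
    refine (isSemialgebraicFunOn_const_of_isAlgebraic hS
      (hK (soloInformedAbsK (b 0 * b 1)))).congr fun z _ => ?_
    rw [soloInformed_det_diagDerivR, soloInformed_algebraMap_absK, map_mul]
  refine soloInformed_presOn_image hS Φ (fun _ => soloInformedDiagDerivR β)
    (IsSemialgebraicMapOn.of_forall hS fun j =>
      (soloInformed_isSemialgebraicFunOn_aevalK hK hS (soloInformedDiagPolyK a b j)).congr
        fun z _ => soloInformed_aeval_diagPolyK a b z j)
    (fun z _ => (soloInformed_hasFDerivAt_diagMoveR α β z).hasFDerivWithinAt)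
    ((soloInformed_diagMoveR_injective hb).injOn) hJ ?_
  refine (soloInformed_presOn_congr fun z _ => ?_).1 h
  simp only [map_mul, MvPolynomial.aeval_C, soloInformed_aeval_diagSubstK,
    soloInformed_det_diagDerivR, soloInformed_algebraMap_absK, map_mul]
  ring

/-! ### PRES-RAT(2) -/

/-- **Bounded rational pieces are presentable.**  A rational representation
`(σ, P/Q)` with `σ` bounded is presentable: the chart `x = -R + 2R z` carries the open unit
square onto `(-R, R)² ⊇ σ`, and the pulled-back problem is decided over `K = ℚ̄ ∩ ℝ` by
`soloInformed_presOn_rational_openCube`. [this work] -/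
theorem soloInformed_presentable_of_isRational_of_isBounded (r : IntegralRep 2)
    (hr : r.IsRational) (hbd : Bornology.IsBounded r.domain) : of r ∈ soloInformedPresentable := by
  obtain ⟨p, q, hq, hpq⟩ := hr
  obtain ⟨R', hR'⟩ := (Metric.isBounded_iff_subset_ball 0).1 hbd
  set R : ℕ := ⌈R'⌉₊ + 1 with hR
  have hRR' : R' < R := by
    rw [hR, Nat.cast_add, Nat.cast_one]
    exact (Nat.le_ceil R').trans_lt (lt_add_one _)
  have hR0 : (0 : ℝ) < R := by rw [hR]; positivity
  have hdom : ∀ x ∈ r.domain, ∀ i, |x i| < R := by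
    intro x hx i
    have hn : ‖x‖ < R := (mem_ball_zero_iff.1 (hR' hx)).trans hRR'
    rw [pi_norm_lt_iff hR0] at hn
    simpa [Real.norm_eq_abs] using hn i
  -- the chart over `K₀ = ℚ̄ ∩ ℝ`
  haveI : CharZero (algebraicClosure ℚ ℝ) := soloInformed_charZero_of_embedding _
  set a : Fin 2 → algebraicClosure ℚ ℝ := fun _ => -((R : ℕ) : algebraicClosure ℚ ℝ) with ha
  set b : Fin 2 → algebraicClosure ℚ ℝ := fun _ => ((2 * R : ℕ) : algebraicClosure ℚ ℝ) with hb
  have hαe : ∀ i, algebraMap (algebraicClosure ℚ ℝ) ℝ (a i) = -(R : ℝ) := fun i => by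
    rw [ha, map_neg, map_natCast]
  have hβe : ∀ i, algebraMap (algebraicClosure ℚ ℝ) ℝ (b i) = 2 * (R : ℝ) := fun i => by
    rw [hb, map_natCast, Nat.cast_mul, Nat.cast_ofNat]
  have hb0 : ∀ i, algebraMap (algebraicClosure ℚ ℝ) ℝ (b i) ≠ 0 := fun i => by
    rw [hβe i]; positivity
  set Φ := soloInformedDiagMoveR (fun i => algebraMap (algebraicClosure ℚ ℝ) ℝ (a i))
    (fun i => algebraMap (algebraicClosure ℚ ℝ) ℝ (b i)) with hΦ
  have hcover : r.domain ⊆ Φ '' soloInformedOpenCube 2 := by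
    intro x hx
    refine ⟨fun i => (x i + R) / (2 * R), fun i => ?_, funext fun i => ?_⟩
    · have h := abs_lt.1 (hdom x hx i)
      constructor
      · apply div_pos <;> linarith [h.1]
      · rw [div_lt_one (by positivity)]; linarith [h.2]
    · rw [hΦ, soloInformedDiagMoveR_apply, hαe i, hβe i]
      field_simp
      ring
  have hdomeq : r.domain = r.domain ∩ Φ '' soloInformedOpenCube 2 :=
    (inter_eq_left.2 hcover).symm
  -- the integrand as a quotient of `K₀`-polynomials
  set pK : MvPolynomial (Fin 2) (algebraicClosure ℚ ℝ) :=
    MvPolynomial.map (algebraMap ℚ (algebraicClosure ℚ ℝ)) p with hpK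
  set qK : MvPolynomial (Fin 2) (algebraicClosure ℚ ℝ) :=
    MvPolynomial.map (algebraMap ℚ (algebraicClosure ℚ ℝ)) q with hqK
  have hpq' : EqOn r.integrand
      (fun z => (MvPolynomial.aeval z pK : ℝ) / MvPolynomial.aeval z qK) r.domain := by
    intro z hz
    rw [hpq hz]
    simp only [hpK, hqK, MvPolynomial.aeval_map_algebraMap]
  suffices hpres : SoloInformedPresOn r.domain
      (fun z => (MvPolynomial.aeval z pK : ℝ) / MvPolynomial.aeval z qK) from hpres r rfl hpq'
  rw [hdomeq]
  refine soloInformed_presOn_inter_diagImage soloInformed_algCoeff_algebraicClosure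
    r.isSemialgebraic_domain a b hb0 pK qK ?_
  refine soloInformed_presOn_rational_openCube soloInformed_algCoeff_algebraicClosure
    soloInformed_realRootClosed_algebraicClosure ?_ (fun z hz => hz.1) _ _ fun z hz h0 => ?_
  · convert soloInformed_isSemialgebraic_sep_preimage soloInformed_algCoeff_algebraicClosure
      (isSemialgebraic_soloInformedOpenCube 2) (soloInformedDiagPolyK a b)
      r.isSemialgebraic_domain using 1
    ext z
    rw [mem_setOf_eq, mem_setOf_eq, soloInformed_diagMoveR_eq_aeval]
  · rw [soloInformed_aeval_diagSubstK, hqK, MvPolynomial.aeval_map_algebraMap] at h0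
    exact hq _ hz.2 h0

/-- **THEOREM PRES-RAT(2).**  Every absolutely convergent integral of a rational function with
rational coefficients over a `ℚ`-semialgebraic plane domain is presentable: the semi-canonical
reduction writes it, modulo the Kontsevich–Zagier relations, as a sum of bounded rational
pieces, each presentable by `soloInformed_presentable_of_isRational_of_isBounded`.
[this work] -/
theorem soloInformed_presRat_two : SoloInformedPresRat 2 := by
  intro r hr
  obtain ⟨Rf, hRf, hrel⟩ := exists_sub_sum_bounded_mem_relations r hr
  exact soloInformed_presentable_of_sub_mem hrel (soloInformed_presentable_sum _ _ fun T _ =>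
    soloInformed_presentable_of_isRational_of_isBounded (Rf T) (hRf T).1 (hRf T).2)

/-- **KZP(≤ 2) for rational integrands from Ayoub's effective conjecture.**  Two absolutely
convergent integrals of rational functions with rational coefficients over `ℚ`-semialgebraic
domains of dimensions `≤ 2` with the same value are equivalent under the Kontsevich–Zagier
rules, granted the effective relative period conjecture `KZ_eff(ℚ)`. [this work] -/
theorem soloInformed_kzpUpTo_two_of_ayoubKZeffQ (hA : SoloInformedAyoubKZeffQ) :
    SoloInformedKZPUpTo 2 :=
  soloInformed_kzpUpTo_of_presRat soloInformed_presRat_two hA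

end Summit.KontsevichZagierPeriods.KontsevichZagierPeriods.Theorems
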